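import Mathlib
import HarnessLib
import HarnessLib.Audit
import Summits.QuantumFields.Statement
import Summits.QuantumFields.YangMills.Theorems.BalabanLadderROTOfKing
import Summits.QuantumFields.YangMills.Theorems.BalabanLadderROTSkewTorus

/-!
Route: CheckerboardTriality

DORMANT since 2026-09-02T22:58:48Z (reconciler: no traction for 5 d (last activity item-evidence-added at 2026-08-28T21:57:45Z); parked, not closed — `ledger route dormant route-QuantumFields-CheckerboardTriality --off` to reactivate) — unstaffed, not closed; items shared with open routes are served there. `ledger route dormant <id> --off` reactivates.

# Route CheckerboardTriality — Hidden triality of the YM₄ limit — W(B₄) ⊂ W(F₄) ⊂ SO(4) by the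
index-2 Hurwitz pair

Restrict-then-tighten on the SYMMETRY GROUP of the off-diagonal continuum limit points of tr F²·F²
correlators along the
leg schemes: hypercubic W(B₄) (free, order 384) ⊂ W(F₄) = Aut(D₄) (order 1152; crux TrialityLimit) ⊂
SO(4) ⊃ SO(2)₀₁
(crux SexticClosure, the widening). It suffices to show X := TrialityLimit ∧ SexticClosure: (K1)
every off-diagonal
limit point S₁ along every admissible scheme is invariant, on King's germ class, under every linear
isometry of ℝ⁴
preserving the checkerboard lattice D₄ = {z ∈ ℤ⁴ : Σ zᵢ even} — reached by comparing the Wilson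
theory on ℤ⁴ with the
Wilson theory on its triality partner R₃ℤ⁴ (R₃ = right multiplication by the Hurwitz unit ω =
(−1+i+j+k)/2, an
isoclinic rotation of order 3), the two hypercubic lattices meeting in the INDEX-2 sublattice D₄ and
living on the SAME
tori ℝ⁴/N·D₄; (K2) a W(F₄)-invariant off-diagonal limit point of a leg scheme is invariant under the
(x₀,x₁)-rotations by
the Pythagorean angles on King's class. Then the tree's King upgrade gives the leaf ROT (rung R2d).
No summit is proved.
Lean: `TrialityLimit ∧ SexticClosure`

## Assembly
Pure logic over the tree: from TrialityLimit get r₀ and the W(F₄)-invariance of every off-diagonal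
limit point along the
scheme; SexticClosure turns it into Pythagorean (x₀,x₁)-invariance on KingClass n r₀; that is the
hypothesis of
`Theorems.ROT.latticeKingWard_of_uvCompactAt_of_limitsKingInvariant` (UV compactness from the PROVED
`Theorems.ROT.stub_uvExtract` and the leaf's own MomentBounds6), and the King upgrade
`latticeRotWard_of_uvCompactAt_of_latticeKingWard` at the dense subgroup
`King.dense_closure_pythagoreanAngles` gives
`LatticeRotWard G r a`, i.e. the leaf ROT (its LowerBounds guard unused, as in the line of record).
glue.lean `closes`
elaborates (Sketch.lean rc 0).

CLOSES_TARGET: closes rung R2d of QuantumFields: Summit.QuantumFields.YangMills.Theses.BalabanLadder.ROT (D-0061; not the summit Statement) — the deciding theorem of this route concludes that registered leaf instead of the Statement decl `YangMills` (class rung: servable and labelled, never counted as concluding the summit Statement).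

Rationale: WHY THIS LINE. The rotation leg ROT (stmt-QuantumFields-20042) has one mechanism of record, King's
two-lattice comparison at the
Pythagorean pair (3,4,5) [King1986, CMP 103 Thm 2.4], whose lattices ℤ⁴ and R_θ ℤ⁴ meet in a
sublattice of index 25 and
need a tilt/commensurability bracket (tree lane A: BalabanLadderROTTilt*, ROTCommensurability, IR
guard), plus the
infinitesimal Ward lane B (shape barrier: MomentBounds6 alone cannot give the Ward identity). This
line imports the
arithmetic of the Hurwitz order [ConwaySloane1999, Ch. 4 §7.1, Ch. 8 §4]: ℤ⁴ and ω-rotated ℤ⁴ are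
the two Lipschitz
sublattices of the Hurwitz lattice, meet in D₄ with index 2, are both N·D₄-periodic, and R₃ ∈
Aut(D₄) = W(F₄) ∖ W(B₄)
(certificate PROVED: bc/TrialityLimit_rung.lean). So the comparison runs on ONE skew torus with an
EXACT isometry, no
tilt bracket, no Pythagorean fitting, and its output is a new intermediate theorem-shaped statement
— W(F₄)-invariance
of the YM₄ limit ("hidden triality"), which kills exactly the quartic (ℓ = 4, O(a²)-class)
hypercubic harmonic since the
F₄ invariants have degrees 2, 6, 8, 12 — strictly between what the lattice gives and OS-E1. The
widening K2 then has two
doors: the lanes of record (no discount claimed), or PencilRigidity's mirror-rigidity engine run on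
the 12 short-root
mirrors of F₄ (conjugates of x₀ = 0 under W(F₄), reflection-positive for free once K1 holds) instead
of the diagonal
mirror x₀ = x₁ whose lattice RP was refuted as typed (negatives: stmt-QuantumFields-9665). Numerics
on F₄-symmetric
LATTICE ACTIONS exist [Celmaster1982] (body-centred hypercubic lattice, improved rotational
restoration; cf.
[LangRebbi1982]); nobody has used the triality PAIR as a universality comparison for the hypercubic
theory.

RANKED CRUXES. #2 TrialityLimit (crux) — For every compact simple G, representation r, positive unit
map a → 0 with MomentBounds6, and every admissible leg scheme, there is r₀ > 0 such that every
off-diagonal limit point S₁ along every subsequence is invariant on King's class KingClass n r₀ (n ≥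
2) under every linear isometry R of ℝ⁴ mapping the checkerboard lattice D₄ into itself (Aut(D₄) =
W(F₄) ⊋ W(B₄)). [difficulty: XL] (why it might fail: King-type universality of two Wilson lattice
theories through the YM₄ crossover is unprinted (only U(1)-Higgs₃); and leg schemes sit on straight
tori L·ℤ⁴, not on the R₃-invariant tori N·D₄, so a torus-shape transfer consuming volume-uniform
locality (lane A's IR guard) is still needed.) [King1986, ConwaySloane1999, Celmaster1982]
#3 SexticClosure (crux) — For every (G, r, a) as above, every admissible leg scheme, every r₀ > 0
and every off-diagonal limit point S₁ along a subsequence: if S₁ is invariant on KingClass n r₀ (all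
n ≥ 2) under every D₄-preserving linear isometry, then S₁ is invariant on KingClass n r₀ under the
(x₀,x₁)-plane rotations by every Pythagorean angle (the widening W(F₄) → SO(2)₀₁; W(F₄) is finite,
so this is a genuine second step, not density). [deps: TrialityLimit] [difficulty: XL] (why it might
fail: W(F₄) is finite: the hypothesis removes only the ℓ = 4 harmonic sector of the defect, ℓ ≥ 6
hypercubic-even sectors remain; without the mirror door it is the rotation leg’s universality wall
again (lanes A/B apply verbatim), and the mirror door is itself open (ShellRigidity-type rigidity).)
[King1986, Celmaster1982, LangRebbi1982]

TWO-LAYER PLAN. TrialityLimit ⇐ TrialityOnCheckerboardTori → CheckerboardTorusTransfer →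
TrialityLimit (k = 2): (i) on the R₃-invariant
period cells N·D₄ (tree `PeriodCell` of BalabanLadderROTSkewTorus) the ℤ⁴ Wilson n-point
distributions of tr F² are
asymptotically R₃-invariant off the diagonal — the genuine two-lattice comparison, both theories on
one torus, R₃ exact;
(ii) transfer from N·D₄-periodic to the schemes' straight tori L·ℤ⁴ (DLR / boundary-decay input of
lane A,
BalabanLadderROTSkewTorusDLR, ROTBoundaryDecayGuard*). SexticClosure ⇐ ShortRootMirrorRigidity →
NPointStep →
SexticClosure (k = 2), the mirror door: W(F₄)-invariance + axis RP makes the limit RP across the 12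
short-root mirrors
(⊥ ±eᵢ and ⊥ (±1,±1,±1,±1)/2, at 60° to the axes); PencilRigidity's kernel rigidity (ShellRigidity,
dormant, unrefuted)
re-typed for that mirror configuration, then its NPointIsotropy step. Nothing here is filed now.

KILL CRITERIA. A Wilson-type scaling limit (or a King-comparison obstruction) showing the ℤ⁴ and
R₃ℤ⁴ theories differ off the diagonal in
the limit closes the route `refuted:TrialityLimit`. An explicit off-diagonal limit point of a YM leg
scheme that is
W(F₄)-invariant but not SO(2)₀₁-invariant on King's class refutes SexticClosure (pivot: none — the
line is dead). If the
line of record's KingLimit / KingSingle is PROVED, this route is moot (superseded); if lane B's Ward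
identity is proved,
likewise. A proof that leg-scheme limit points are automatically SO(4)-invariant given MomentBounds6
(impossible by the
tree's shape barrier BalabanLadderROTWardShape) would moot both.

NOT DECOMPOSED YET. The torus-shape transfer (N·D₄-periodic ↔ L·ℤ⁴-periodic), the choice of N(k)
along a scheme, the King comparison's
large-field/crossover control, and the mirror door's kernel class (singularity threshold below
|x|⁻¹⁰ as in
PencilRigidity) are layer-2 children, filed only after a crux moves.

CHEAPEST FALSIFIER. (1) The arithmetic of the lever — decidable and RUN: bc/TrialityLimit_rung.lean
(lean check rc 0, no sorry): M = 2R₃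
satisfies M Mᵀ = 4·1, M³ = 8·1, det M = 16, (R₃ z ∈ ℤ⁴ ↔ z ∈ D₄), R₃ D₄ ⊆ D₄ with even sums, R₃ e₀ ∉
ℤ⁴. PASSED. (2) The
instrument row: SU(2) Monte Carlo on D₄-periodic lattices (periods N·D₄, N = 4,6,8) — the triality
defect
δ₃(β) = ⟨P̃(0)P̃(x)⟩ − ⟨P̃(0)P̃(R₃x)⟩ of the smeared-plaquette two-point function at fixed physical
|x| must fall like
a(β)² (with the ℓ = 4 cubic-harmonic coefficient c₄ of [LangRebbi1982]); a defect that does not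
decrease with β kills
TrialityLimit. Not run (compute discipline; one batched kit job would do it).

NUMBERS. |W(B₄)| = 384, |W(F₄)| = |Aut(D₄)| = 1152, [ℤ⁴ : D₄] = [Hurwitz : ℤ⁴] = 2 (vs index 25 for
the (3,4,5) pair); degrees
of the basic invariants: B₄ 2,4,6,8 — F₄ 2,6,8,12 (first anisotropic W(F₄)-invariant harmonic at ℓ =
6); R₃ has order 3,
rotation angle 2π/3 in both isoclinic planes; short roots of F₄ = 24 vectors ±eᵢ, (±1,±1,±1,±1)/2
(12 mirrors), at 60°/90°
to the axes [ConwaySloane1999].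

DEFINITION REQUESTS. None: D₄-preservation is inlined (∀ z even-sum, ∃ w even-sum, R (siteToE z) =
siteToE w); `siteToE`, `linActMulti`,
`King.KingClass`, `OffDiagLimitAlong`, `IsLegScheme` are tree declarations.

Novelty: Searches (2026-08-28): `lit search "Celmaster body-centered hypercubic lattice gauge"` (local 4
citing hits; crossref 6: Celmaster PRD 26 (1982) 2955, PRD 28 (1983) 2076, PRL 52 (1984) 403, CPC
1985, PRD 33 (1986) ×2); `lit search --hybrid "lattice gauge theory on the F4 lattice 24-cell
improved rotational invariance"` (6 book hits: [corpus:montvay1994-quantum-fields-lattice p.13,161],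
Greensite 2011 — none on a triality comparison); `lit galaxy search "body-centered hypercubic|F4
lattice|Hurwitz quaternions lattice gauge" --star all` ([galaxy:panama:239306987798613] Lattice
Higgs Workshop 1988; [galaxy:panama:249271311925307] Lattice Gas Hydrodynamics (FCHC/F₄ isotropy of
lattice gases); pdf/crabby 0 relevant); `lit search "King U(1) Higgs continuum limit rotation
lattice" --source local` ([corpus:king1986-cmp103-king-u1-higgs-ii p.1,4]); tree `rg
"F₄|triality|Hurwitz|24-cell|Celmaster|checkerboard"` over Summits/QuantumFields and
Literature/MathematicalPhysics: 0 hits (99 YM route files, 42 BalabanLadderROT* theorem files);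
`ledger negatives --problem QuantumFields`: 8 entries, none on a finite symmetry enlargement.
Nearest prior art found: Celmaster1982 (doi:10.1103/physrevd.26.2955) — simulates SU(2) ON the
body-centred hypercubic (F₄-symmetric) lattice for faster rotational restoration; King1986 —
two-lattice universality comparison at a Pythagorean pair (index 25) for U(1)-Higgs₃; tree line of
record KingLimit/KingSingle (BalabanLadderROTDefs) and PencilRigidity (16 B₄-  [refs: 10.1103/physrevd.26.2955, doi:10.1103/physrevd.26.2955, Celmaster1982, King1986]

Barriers (technique_class: two-lattice-comparison, symmetry-enlargement): - technique_class: two-lattice-comparison, symmetry-enlargement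
- Literature.Barriers.QuantumFields.RegularisationDichotomy: outside its class — no regulator is
claimed to be both Euclidean-invariant and RP; both compared theories are RP Wilson theories on
hypercubic lattices and W(F₄) is a symmetry of NEITHER at finite cutoff, only of the limit (an
asymptotic universality statement, not finite-cutoff axiom inheritance).
- Literature.Barriers.QuantumFields.ImprovedActionPositivityViolation: evaded — no improved or
F₄-lattice action (contrast Celmaster1982) is used; the Wilson action on ℤ⁴ and on R₃ℤ⁴ keeps its
transfer matrix.
- Literature.Barriers.QuantumFields.UVStabilityNonUniqueness: it does not evade it; the bet is
King's mechanism — control of the DIFFERENCE of the two theories' expectations through Bałaban's RG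
steps (more than a stability certificate), here with the cleanest arithmetic available (index 2, one
torus, exact isometry). TrialityLimit is priced at the universality wall like the line of record.
- Literature.Barriers.QuantumFields.PerturbativeInvisibility: not in its class — no mass or rate is
read off perturbation theory; Symanzik O(a²) counting is motivation for the instrument row only.
- Negatives index: steers around stmt-QuantumFields-9665 (DiagonalMirrorRP, refuted by a zero-point
vacuity witness): the mirror door uses conjugates of the AXIS mirror under a symmetry of the limit
and quantifies only over limit points with OffDiagLimitAlong (n ≥ 2 clauses

History (route lifecycle, newest last):
- 2026-08-28T20:57:58Z · rev 3: informal re-worded for Sigma3Limit (planner-ym-idea-1-g10-0)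
- 2026-09-02T22:58:48Z · DORMANT — reconciler: no traction for 5 d (last activity item-evidence-added at 2026-08-28T21:57:45Z); parked, not closed — `ledger route dormant route-QuantumFields-Chec (operator:999:1705525)

sub-problem: YangMills · status: dormant · opened planner-ym-idea-1-g8-0 2026-08-28T16:02:07Z · rev 5 · ledger route-QuantumFields-CheckerboardTriality
GENERATED by the gate from the ledger (D-0016/17). Provers cite these decls: `theorem foo : Summit.QuantumFields.YangMills.Theses.CheckerboardTriality.<Decl> := …` in Summits/QuantumFields/YangMills/Theorems/<Name>.lean.
-/

namespace Summit.QuantumFields.YangMills.Theses.CheckerboardTriality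

open scoped BigOperators Topology Manifold Classical MeasureTheory ProbabilityTheory Matrix InnerProductSpace ComplexConjugate ContinuousMap
open Filter Set Function TopologicalSpace MeasureTheory

attribute [summit_statement] _root_.YangMills
attribute [summit_statement] _root_.Summit.QuantumFields.YangMills.Theses.BalabanLadder.ROT

/-- item stmt-QuantumFields-22566 · crux · rank 2 · SPLIT (gen 1) into TrialityOnCheckerboardCells, CheckerboardCoverTransfer, CheckerboardCellsExist + glue TrialityLimitOfCells · direct attempts still welcome (low priority) · by planner
why it might fail: King-type universality of two Wilson lattice theories through the YM₄ crossover is unprinted (only U(1)-Higgs₃); and leg schemes sit on straight tori L·ℤ⁴, not on the R₃-invariant tori N·D₄, so a torus-shape transfer consuming volume-uniform locality (lane A's IR guard) is still needed.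
sources: King1986, ConwaySloane1999, Celmaster1982
[crux] For every compact simple G, representation r, positive unit map a → 0 with MomentBounds6, and
every admissible leg scheme, there is r₀ > 0 such that every off-diagonal limit point S₁ along every
subsequence is invariant on King's class KingClass n r₀ (n ≥ 2) under every linear isometry R of ℝ⁴
mapping the checkerboard lattice D₄ into itself (Aut(D₄) = W(F₄) ⊋ W(B₄)). [difficulty: XL] -/
@[route_item "route-QuantumFields-CheckerboardTriality"]
def TrialityLimit : Prop :=
  open Literature.MathematicalPhysics.QuantumFieldTheory Literature.MathematicalPhysics.QuantumLattice Literature.MathematicalPhysics.AQFT Literature.Probability.LatticeModels Summit.QuantumFields.YangMills.Cruxes.OSLegsFromFemtoAndGap.DlrCollarTransfer Summit.QuantumFields.YangMills.Cruxes.OSLegsAtWeakCouplingC.Sketch Summit.QuantumFields.YangMills.Cruxes.OSLegsAtWeakCouplingC.Y2Bridge Summit.QuantumFields.YangMills.Theorems.ROT in ∀ (G : Type) [Group G] [TopologicalSpace G] [IsTopologicalGroup G] [CompactSpace G], IsCompactSimpleLieGroup G → letI : MeasurableSpace G := borel G; haveI : BorelSpace G := ⟨rfl⟩; ∀ (r :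 LatticeRep G) (a : ℝ → ℝ), (∀ β, 0 < a β) → Tendsto a atTop (nhds 0) → MomentBounds6 G r a → ∀ sch : SpeciesScheme (YMSpecies G), IsLegScheme a sch → ∃ r₀ : ℝ, 0 < r₀ ∧ ∀ φ : ℕ → ℕ, Tendsto φ atTop atTop → ∀ S₁ : SchwingerFamily (EuclideanSpace ℝ (Fin 4)), OffDiagLimitAlong r sch φ S₁ → ∀ (n : ℕ), 2 ≤ n → ∀ F ∈ King.KingClass n r₀, ∀ R : EuclideanSpace ℝ (Fin 4) ≃ₗᵢ[ℝ] EuclideanSpace ℝ (Fin 4), (∀ z : Fin 4 → ℤ, Even (∑ i, z i) → ∃ w : Fin 4 → ℤ, Even (∑ i, w i) ∧ R (siteToE z) = siteToE w) → S₁ n (linActMulti R F) = S₁ n F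

-- parent: TrialityLimit · child (gen 1)
/--     item stmt-QuantumFields-22666 · crux · rank 201 · open
    parent: TrialityLimit · by planner
    why it might fail: It is a two-lattice universality statement through the YM₄ crossover (King's mechanism is printed only for U(1)-Higgs₃); as typed it carries no clustering hypothesis, so a massless or non-unique limit could let the two regularisations differ at physical scales.
    sources: King1986, ConwaySloane1999, Celmaster1982
[crux] The King comparison proper, on ONE torus: for every (G, r, a) with MomentBounds6, every
admissible leg scheme and every sequence of checkerboard period cells C_k = ℤ⁴/((2L_k+1)·D₄) (the
double covers of the schemes' tori, transversal ⊇ the centred box), there is r₀ > 0 such that for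
every F in King's class and every D₄-preserving linear isometry R (Aut(D₄) = W(F₄)), dist_{C_k}(R·F)
− dist_{C_k}(F) → 0: the ℤ⁴ Wilson theory and its triality partner R·ℤ⁴ (both (2L_k+1)·D₄-periodic,
R an exact isometry of the torus) have asymptotically equal off-diagonal tr F² distributions. -/
@[route_item "route-QuantumFields-CheckerboardTriality"]
def TrialityOnCheckerboardCells : Prop :=
  open Literature.MathematicalPhysics.QuantumFieldTheory Literature.MathematicalPhysics.QuantumLattice Literature.MathematicalPhysics.AQFT Literature.Probability.LatticeModels Summit.QuantumFields.YangMills.Cruxes.OSLegsFromFemtoAndGap.DlrCollarTransfer Summit.QuantumFields.YangMills.Cruxes.OSLegsAtWeakCouplingC.Sketch Summit.QuantumFields.YangMills.Cruxes.OSLegsAtWeakCouplingC.Y2Bridge Summit.QuantumFields.YangMills.Theorems.ROT in ∀ (G : Type) [Group G] [TopologicalSpace G] [IsTopologicalGroup G] [CompactSpace G], IsCompactSimpleLieGroup G → letI : MeasurableSpace G := borel G; haveI : BorelSpace G := ⟨rfl⟩; ∀ (r : LatticeRep G) (a : ℝ → ℝ), (∀ β, 0 < a β) → Tendsto a atTop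 (nhds 0) → MomentBounds6 G r a → ∀ sch : SpeciesScheme (YMSpecies G), IsLegScheme a sch → ∀ C : ℕ → PeriodCell 4, (∀ k, ((C k).P : Set (Fin 4 → ℤ)) = {z | ∃ w : Fin 4 → ℤ, Even (∑ i, w i) ∧ z = ((2 * sch.L k + 1 : ℕ) : ℤ) • w} ∧ box 4 (sch.L k) ⊆ (C k).reps) → ∃ r₀ : ℝ, 0 < r₀ ∧ ∀ (n : ℕ), 2 ≤ n → ∀ F ∈ King.KingClass n r₀, ∀ R : EuclideanSpace ℝ (Fin 4) ≃ₗᵢ[ℝ] EuclideanSpace ℝ (Fin 4), (∀ z : Fin 4 → ℤ, Even (∑ i, z i) → ∃ w : Fin 4 → ℤ, Even (∑ i, w i) ∧ R (siteToE z) = siteToE w) → Tendsto (fun k => (C k).dist r.ρ (sch.β k) (fun z => (sch.a k) • siteToE z) r.curvature.F ((C k).mean r.ρ (sch.β k) r.curvature.F) n (linActMulti R F) - (C k).dist r.ρ (sch.β k) (fun z => (sch.a k) • siteToE z) r.curvature.F ((C k).mean r.ρ (sch.β k) r.curvature.F) n F) atTop (nhds 0)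

-- parent: TrialityLimit · child (gen 1)
/--     item stmt-QuantumFields-22667 · crux · rank 202 · open
    parent: TrialityLimit · by planner
    why it might fail: As typed it has no GapInUnits/clustering hypothesis (the leaf ROT supplies none — lane A's IR-guard finding): a torus and its double cover can be told apart by a massless or phase-coexisting limit point even as the physical size diverges.
    sources: King1986, GlimmJaffe1987
[crux] Torus-shape transfer: along every admissible leg scheme the ℤ⁴ Wilson n-point distributions
of tr F² on the checkerboard double cover ℤ⁴/((2L_k+1)·D₄) and on the straight torus
ℤ⁴/((2L_k+1)·ℤ⁴) (the tree's latticeDist) differ by o(1) on every off-diagonal compactly supported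
test function — finite-size insensitivity at physical size (2L_k+1)a_k ≥ a_k⁻¹ → ∞ (lane A's
volume-uniform locality / DLR input, here for a 2-sheeted cover instead of a tilted cell). -/
@[route_item "route-QuantumFields-CheckerboardTriality"]
def CheckerboardCoverTransfer : Prop :=
  open Literature.MathematicalPhysics.QuantumFieldTheory Literature.MathematicalPhysics.QuantumLattice Literature.MathematicalPhysics.AQFT Literature.Probability.LatticeModels Summit.QuantumFields.YangMills.Cruxes.OSLegsFromFemtoAndGap.DlrCollarTransfer Summit.QuantumFields.YangMills.Cruxes.OSLegsAtWeakCouplingC.Sketch Summit.QuantumFields.YangMills.Cruxes.OSLegsAtWeakCouplingC.Y2Bridge Summit.QuantumFields.YangMills.Theorems.ROT Summit.QuantumFields.YangMills.Theorems.OSLegsFromFemtoAndGap in ∀ (G : Type) [Group G] [TopologicalSpace G] [IsTopologicalGroup G] [CompactSpace G], IsCompactSimpleLieGroup G → letI : MeasurableSpace G := borel G; haveI : BorelSpace G := ⟨rfl⟩; ∀ (r : LatticeRep G) (a : ℝ → ℝ), (∀ β, 0 < a β) → Tendsto a atTop (nhds 0) → MomentBounds6 G r a → ∀ sch : SpeciesScheme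 (YMSpecies G), IsLegScheme a sch → ∀ C : ℕ → PeriodCell 4, (∀ k, ((C k).P : Set (Fin 4 → ℤ)) = {z | ∃ w : Fin 4 → ℤ, Even (∑ i, w i) ∧ z = ((2 * sch.L k + 1 : ℕ) : ℤ) • w} ∧ box 4 (sch.L k) ⊆ (C k).reps) → ∀ (n : ℕ), 2 ≤ n → ∀ F : SchwartzMap (Fin n → EuclideanSpace ℝ (Fin 4)) ℂ, IsOffDiagonal F → HasCompactSupport (F : (Fin n → EuclideanSpace ℝ (Fin 4)) → ℂ) → Tendsto (fun k => (C k).dist r.ρ (sch.β k) (fun z => (sch.a k) • siteToE z) r.curvature.F ((C k).mean r.ρ (sch.β k) r.curvature.F) n F - latticeDist r.ρ (sch.β k) (sch.L k) (sch.a k) r.curvature.F (wilsonTorusMean r.ρ (sch.β k) (sch.L k) r.curvature.F) n F) atTop (nhds 0)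

-- parent: TrialityLimit · child (gen 1)
/--     item stmt-QuantumFields-22668 · support · rank 203 · closed · proved by Summit.QuantumFields.YangMills.Theorems.checkerboardTriality_checkerboardCellsExist_proof (prover)
    parent: TrialityLimit · by planner
    sources: ConwaySloane1999
[support, provable-now] For every L there is a period cell of ℤ⁴ with period lattice (2L+1)·D₄ (D₄ =
even coordinate sum) whose transversal contains the centred box [−L,L]⁴ (take reps = box ∪ (box +
(2L+1)e₃), red = centred reduction mod (2L+1) followed by the parity correction). -/
@[route_item "route-QuantumFields-CheckerboardTriality"]
def CheckerboardCellsExist : Prop :=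
  open Summit.QuantumFields.YangMills.Theorems.ROT in ∀ L : ℕ, ∃ C : PeriodCell 4, (C.P : Set (Fin 4 → ℤ)) = {z | ∃ w : Fin 4 → ℤ, Even (∑ i, w i) ∧ z = ((2 * L + 1 : ℕ) : ℤ) • w} ∧ Literature.Probability.LatticeModels.box 4 L ⊆ C.reps

-- `CheckerboardCellsExist` holds: proved by `Summit.QuantumFields.YangMills.Theorems.checkerboardTriality_checkerboardCellsExist_proof` (its module imports this route file, so no `_holds` link can be stated here).

-- parent: TrialityLimit · glue (gen 1)
/--     item stmt-QuantumFields-22669 · support · rank 204 · closed · proved by Summit.QuantumFields.YangMills.Theorems.checkerboardTriality_trialityLimitOfCells_proof (prover)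
    parent: TrialityLimit · GLUE: children ⟹ parent · by planner
CheckerboardCellsExist → TrialityOnCheckerboardCells → CheckerboardCoverTransfer → TrialityLimit:
choose the checkerboard double covers C_k (support), get r₀ and asymptotic Aut(D₄)-invariance on the
cells (C1), transfer both F and R·F to the straight tori (C2, King's class is isometry-stable),
conclude by uniqueness of limits along φ — PROVED in the planner folder Sketch2.lean
(trialityLimit_of_cells, rc 0, no sorry). -/
@[route_item "route-QuantumFields-CheckerboardTriality"]
def TrialityLimitOfCells : Prop :=
  TrialityOnCheckerboardCells → CheckerboardCoverTransfer → CheckerboardCellsExist → TrialityLimit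

-- `TrialityLimitOfCells` holds: proved by `Summit.QuantumFields.YangMills.Theorems.checkerboardTriality_trialityLimitOfCells_proof` (its module imports this route file, so no `_holds` link can be stated here).

/-- item stmt-QuantumFields-22567 · crux · rank 3 · SPLIT (gen 1) into Sigma3Limit, Sigma3DenseUpgrade + glue SexticClosureOfSigma3 · direct attempts still welcome (low priority) · by planner
why it might fail: W(F₄) is finite: the hypothesis removes only the ℓ = 4 harmonic sector of the defect, ℓ ≥ 6 hypercubic-even sectors remain; without the mirror door it is the rotation leg’s universality wall again (lanes A/B apply verbatim), and the mirror door is itself open (ShellRigidity-type rigidity).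
sources: King1986, Celmaster1982, LangRebbi1982
[crux] For every (G, r, a) as above, every admissible leg scheme, every r₀ > 0 and every
off-diagonal limit point S₁ along a subsequence: if S₁ is invariant on KingClass n r₀ (all n ≥ 2)
under every D₄-preserving linear isometry, then S₁ is invariant on KingClass n r₀ under the
(x₀,x₁)-plane rotations by every Pythagorean angle (the widening W(F₄) → SO(2)₀₁; W(F₄) is finite,
so this is a genuine second step, not density). [deps: TrialityLimit] [difficulty: XL] -/
@[route_item "route-QuantumFields-CheckerboardTriality"]
def SexticClosure : Prop :=
  open Literature.MathematicalPhysics.QuantumFieldTheory Literature.MathematicalPhysics.QuantumLattice Literature.MathematicalPhysics.AQFT Literature.Probability.LatticeModels Summit.QuantumFields.YangMills.Cruxes.OSLegsFromFemtoAndGap.DlrCollarTransfer Summit.QuantumFields.YangMills.Cruxes.OSLegsAtWeakCouplingC.Sketch Summit.QuantumFields.YangMills.Cruxes.OSLegsAtWeakCouplingC.Y2Bridge Summit.QuantumFields.YangMills.Theorems.ROT in ∀ (G : Type) [Group G] [TopologicalSpace G] [IsTopologicalGroup G] [CompactSpace G], IsCompactSimpleLieGroup G → letI : MeasurableSpace G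 := borel G; haveI : BorelSpace G := ⟨rfl⟩; ∀ (r : LatticeRep G) (a : ℝ → ℝ), (∀ β, 0 < a β) → Tendsto a atTop (nhds 0) → MomentBounds6 G r a → ∀ sch : SpeciesScheme (YMSpecies G), IsLegScheme a sch → ∀ r₀ : ℝ, 0 < r₀ → ∀ φ : ℕ → ℕ, Tendsto φ atTop atTop → ∀ S₁ : SchwingerFamily (EuclideanSpace ℝ (Fin 4)), OffDiagLimitAlong r sch φ S₁ → (∀ (n : ℕ), 2 ≤ n → ∀ F ∈ King.KingClass n r₀, ∀ R : EuclideanSpace ℝ (Fin 4) ≃ₗᵢ[ℝ] EuclideanSpace ℝ (Fin 4), (∀ z : Fin 4 → ℤ, Even (∑ i, z i) → ∃ w : Fin 4 → ℤ, Even (∑ i, w i) ∧ R (siteToE z) = siteToE w) → S₁ n (linActMulti R F) = S₁ n F) → ∀ (n : ℕ), 2 ≤ n → ∀ F ∈ King.KingClass n r₀, ∀ θ ∈ (King.pythagoreanAngles : Set ℝ), S₁ n (linActMulti (planeRot (0 : Fin 3) θ) F) = S₁ n F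

-- parent: SexticClosure · child (gen 1)
/--     item stmt-QuantumFields-23398 · aside · rank 301 · open
    parent: SexticClosure · by planner
    why it might fail: King's two-regularisation comparison (ℤ⁴ vs g₃ℤ⁴, index 3) through the YM₄ crossover: no printed non-perturbative control of the difference of the two Wilson theories (RegularisationDichotomy, lane-A wall); a non-unique/scheme-dependent UV limit point could separate them; asks ∀ r₀ not ∃ r₀.
    sources: King1986, Literature.Barriers.QuantumFields.RegularisationDichotomy, Grimmer1974:doi:10.1016/0036-9748(74)90334-2, Balaban1989b
[crux, LINE g10-A «sigma3-twin» of SexticClosure; planner ym-idea-1 g10, technique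
restrict-then-tighten] LABEL (critic idea-crit-4 P1, 2026-08-28T20:43Z, paid): Sigma3Limit ≡ ROT
(R2d, BalabanLadder.ROT stmt-QuantumFields-20042) MODULO provable glue — Sigma3DenseUpgrade
(stmt-QuantumFields-23399, Niven + King.continuous_orbit + SO(3) generation) plus the lattice's
exact W(B₄)-invariance of every off-diagonal limit point (hypercubic symmetry of the Wilson theory,
S/M) give Sigma3Limit → ROT; ROT → Sigma3Limit is trivial since g₃ ∈ SO(4). It does NOT split
SexticClosure's difficulty: it RELOCATES the whole R2d wall (Literature.Barriers
RegularisationDichotomy, lane A) into ONE two-regularisation comparison at coincidence index 3.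
TrialityLimit (index 2) is NOT consumed on this path — CheckerboardTriality = lane A at indices 2
and 3, two faces of ONE wall; third face = Theorems.ROT.rot_of_kingSingleLimit (index 5,
(x₀,x₁)-plane). Census value: «variant face of lane A», C0 Lever 2/5, XL wall-carrier. Σ3 TWIN
INVARIANCE OF THE UV LIMIT POINTS: for every compact simple G, lattice representation r, positive
unit a → 0 with MomentBounds6 G r a, every leg scheme, EVERY germ radius r₀ > 0, -/
@[route_item "route-QuantumFields-CheckerboardTriality"]
def Sigma3Limit : Prop :=
  open Literature.MathematicalPhysics.QuantumFieldTheory Literature.MathematicalPhysics.QuantumLattice Literature.MathematicalPhysics.AQFT Literature.Probability.LatticeModels Summit.QuantumFields.YangMills.Cruxes.OSLegsFromFemtoAndGap.DlrCollarTransfer Summit.QuantumFields.YangMills.Cruxes.OSLegsAtWeakCouplingC.Sketch Summit.QuantumFields.YangMills.Cruxes.OSLegsAtWeakCouplingC.Y2Bridge Summit.QuantumFields.YangMills.Theorems.ROT in ∀ (G : Type) [Group G] [TopologicalSpace G] [IsTopologicalGroup G] [CompactSpace G], IsCompactSimpleLieGroup G → letI : MeasurableSpace G := borel G; haveI : BorelSpace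 G := ⟨rfl⟩; ∀ (r : LatticeRep G) (a : ℝ → ℝ), (∀ β, 0 < a β) → Tendsto a atTop (nhds 0) → MomentBounds6 G r a → ∀ sch : SpeciesScheme (YMSpecies G), IsLegScheme a sch → ∀ r₀ : ℝ, 0 < r₀ → ∀ φ : ℕ → ℕ, Tendsto φ atTop atTop → ∀ S₁ : SchwingerFamily (EuclideanSpace ℝ (Fin 4)), OffDiagLimitAlong r sch φ S₁ → ∀ (n : ℕ), 2 ≤ n → ∀ F ∈ King.KingClass n r₀, ∀ R : EuclideanSpace ℝ (Fin 4) ≃ₗᵢ[ℝ] EuclideanSpace ℝ (Fin 4), (∀ x : EuclideanSpace ℝ (Fin 4), R x 0 = x 0 ∧ R x 1 = (x 1 + 2 * x 2 + 2 * x 3) / 3 ∧ R x 2 = (2 * x 1 + x 2 - 2 * x 3) / 3 ∧ R x 3 = (-2 * x 1 + 2 * x 2 - x 3) / 3) → S₁ n (linActMulti R F) = S₁ n F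

-- parent: SexticClosure · child (gen 1)
/--     item stmt-QuantumFields-23399 · support · rank 302 · closed · proved by Summit.QuantumFields.YangMills.Theorems.checkerboardTriality_sigma3DenseUpgrade_proof (prover)
    parent: SexticClosure · by planner
[support, provable now, M/L] DENSITY UPGRADE: (i) the Σ3 rotation exists as a linear isometry of ℝ⁴
with the stated rational coordinates (rows orthonormal, det 1); (ii) for every one-field family S₁
with OffDiagDensity, every n ≥ 2 and r₀ > 0: invariance of S₁ n on KingClass n r₀ under all
D₄-preserving isometries (only the signed permutations W(B₄) are used) and under g₃ implies
invariance under planeRot 0 θ for every Pythagorean θ (indeed every θ). Proof route: cos φ = −1/3 ∉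
{0, ±1/2, ±1} ⇒ φ/π irrational (Mathlib Niven, as in Theorems.BalabanLadderROTSingleAngle); the
angle stabiliser of the class along the circle of rotations about the axis e₁+e₂ is a closed
subgroup (King.continuous_orbit transported by a fixed isometry, King.linActMulti_mem_kingClass)
containing φℤ, hence everything; conjugating by the sign change x₂ ↦ −x₂ ∈ W(B₄) gives the circle
about e₁−e₂; two perpendicular spatial circles generate SO(3)_spatial (Euler: Rot_{e₃}(θ) =
Rot_{u'}(π/2) Rot_{u}(θ) Rot_{u'}(−π/2)), which contains the (x₁,x₂)-rotations; the axis permutation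
x₀ ↔ x₂ ∈ W(B₄) carries them to planeRot 0 θ. TIGHTEN step of the line; pure group theory + the
tree's orbit continuity. -/
@[route_item "route-QuantumFields-CheckerboardTriality"]
def Sigma3DenseUpgrade : Prop :=
  open Literature.MathematicalPhysics.QuantumFieldTheory Literature.MathematicalPhysics.QuantumLattice Literature.MathematicalPhysics.AQFT Literature.Probability.LatticeModels Summit.QuantumFields.YangMills.Cruxes.OSLegsFromFemtoAndGap.DlrCollarTransfer Summit.QuantumFields.YangMills.Cruxes.OSLegsAtWeakCouplingC.Sketch Summit.QuantumFields.YangMills.Cruxes.OSLegsAtWeakCouplingC.Y2Bridge Summit.QuantumFields.YangMills.Theorems.ROT in (∃ R : EuclideanSpace ℝ (Fin 4) ≃ₗᵢ[ℝ] EuclideanSpace ℝ (Fin 4), ∀ x : EuclideanSpace ℝ (Fin 4), R x 0 = x 0 ∧ R x 1 = (x 1 + 2 * x 2 + 2 * x 3) / 3 ∧ R x 2 = (2 * x 1 + x 2 - 2 * x 3) / 3 ∧ R x 3 = (-2 * x 1 + 2 * x 2 - x 3) / 3) ∧ ∀ S₁ : SchwingerFamily (EuclideanSpace ℝ (Fin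 4)), OffDiagDensity S₁ → ∀ (n : ℕ), 2 ≤ n → ∀ r₀ : ℝ, 0 < r₀ → (∀ F ∈ King.KingClass n r₀, ∀ R : EuclideanSpace ℝ (Fin 4) ≃ₗᵢ[ℝ] EuclideanSpace ℝ (Fin 4), (∀ z : Fin 4 → ℤ, Even (∑ i, z i) → ∃ w : Fin 4 → ℤ, Even (∑ i, w i) ∧ R (siteToE z) = siteToE w) → S₁ n (linActMulti R F) = S₁ n F) → (∀ F ∈ King.KingClass n r₀, ∀ R : EuclideanSpace ℝ (Fin 4) ≃ₗᵢ[ℝ] EuclideanSpace ℝ (Fin 4), (∀ x : EuclideanSpace ℝ (Fin 4), R x 0 = x 0 ∧ R x 1 = (x 1 + 2 * x 2 + 2 * x 3) / 3 ∧ R x 2 = (2 * x 1 + x 2 - 2 * x 3) / 3 ∧ R x 3 = (-2 * x 1 + 2 * x 2 - x 3) / 3) → S₁ n (linActMulti R F) = S₁ n F) → ∀ F ∈ King.KingClass n r₀, ∀ θ ∈ (King.pythagoreanAngles : Set ℝ), S₁ n (linActMulti (planeRot (0 : Fin 3) θ) F) = S₁ n F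

-- `Sigma3DenseUpgrade` holds: proved by `Summit.QuantumFields.YangMills.Theorems.checkerboardTriality_sigma3DenseUpgrade_proof` (its module imports this route file, so no `_holds` link can be stated here).

-- parent: SexticClosure · glue (gen 1)
/--     item stmt-QuantumFields-23400 · support · rank 303 · closed · proved by Summit.QuantumFields.YangMills.Theorems.checkerboardTriality_sexticClosureOfSigma3_proof (prover)
    parent: SexticClosure · GLUE: children ⟹ parent · by planner
Sigma3Limit → Sigma3DenseUpgrade → SexticClosure: at a limit point S₁ (OffDiagDensity from
OffDiagLimitAlong, clause 2) feed the W(F₄)-hypothesis of SexticClosure and the Σ3 invariance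
(Sigma3Limit at the same G r a sch r₀ φ S₁) into the density upgrade; PROVED in the attached
skeleton lineA/SexticClosure_sigma3.lean (theorem sexticClosure_of_sigma3, kernel-checked, rc 0,
sorries = 2 = stubs). LINE g10-A «sigma3-twin» of planner ym-idea-1 g10; no summit/leg/rung proved. -/
@[route_item "route-QuantumFields-CheckerboardTriality"]
def SexticClosureOfSigma3 : Prop :=
  Sigma3Limit → Sigma3DenseUpgrade → SexticClosure

-- `SexticClosureOfSigma3` holds: proved by `Summit.QuantumFields.YangMills.Theorems.checkerboardTriality_sexticClosureOfSigma3_proof` (its module imports this route file, so no `_holds` link can be stated here).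

/-- item stmt-QuantumFields-23424 · aside · rank 9 · closed · proved by Summit.QuantumFields.YangMills.Theorems.checkerboardTriality_rotOfSigma3Limit_proof (planner) · by planner
[support · DOOR / census certificate, not load-bearing for closes (aside-eligible); LINE g10-A
sigma3-twin, planner ym-idea-1 g10, requested by critic idea-crit-4 P1 20:43Z] Sigma3Limit ALONE
implies the R2d crux BalabanLadder.ROT — WITHOUT TrialityLimit: the lattice W(B₄)-invariance of
every off-diagonal limit point (tree:
CheckerboardTrialityHyperoctahedral.signedPerm_invariant_of_offDiagLimitAlong), the Σ3 density
upgrade (tree: Sigma3.planeRot_invariant_of_signedPerm_of_sigma3, item 23399 closed) and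
rot_of_kingLimit. Shows in kernel that CheckerboardTriality = lane A at indices 2 and 3 (two faces
of RegularisationDichotomy) and that 23398 ≡ ROT modulo provable glue (ROT → Sigma3Limit is the
trivial direction, not filed). Provable now (S): proof file ready. -/
@[route_item "route-QuantumFields-CheckerboardTriality"]
def RotOfSigma3Limit : Prop :=
  Sigma3Limit → Summit.QuantumFields.YangMills.Theses.BalabanLadder.ROT

-- `RotOfSigma3Limit` holds: proved by `Summit.QuantumFields.YangMills.Theorems.checkerboardTriality_rotOfSigma3Limit_proof` (its module imports this route file, so no `_holds` link can be stated here).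

/-- item stmt-QuantumFields-22568 · assembly · rank 1 · closed · proved by Summit.QuantumFields.YangMills.Theorems.checkerboardTriality_assembly_proof (prover) · by planner
sources: King1986
[assembly] TrialityLimit → SexticClosure → ROT (rung R2d of BalabanLadder). -/
@[route_item "route-QuantumFields-CheckerboardTriality"]
def Assembly : Prop :=
  TrialityLimit → SexticClosure → Summit.QuantumFields.YangMills.Theses.BalabanLadder.ROT

-- `Assembly` holds: proved by `Summit.QuantumFields.YangMills.Theorems.checkerboardTriality_assembly_proof` (its module imports this route file, so no `_holds` link can be stated here).

/-! D-0027 §2.1 — DECIDING THEOREM (planner-authored via `route open/edit --closes-file`; by planner-ym-idea-1-g8-0 2026-08-28T16:02:07Z):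
its hypotheses are this route's items and its conclusion the registered leaf `Summit.QuantumFields.YangMills.Theses.BalabanLadder.ROT` (rung R2d, D-0061) (glue_lint), and it elaborates with this file. -/

@[closes "route-QuantumFields-CheckerboardTriality"] theorem closes (hA : Assembly) (h₁ : TrialityLimit) (h₂ : SexticClosure) : Summit.QuantumFields.YangMills.Theses.BalabanLadder.ROT :=
  hA h₁ h₂

end Summit.QuantumFields.YangMills.Theses.CheckerboardTriality
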